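import Summits.QuantumFields.BalabanUV.T4Continuum.Support.NE7AccumulatedFrameDefectRemCornerSumsL1
import Summits.QuantumFields.BalabanUV.T4Continuum.Support.NE7CornerSpikeTopDictionary
import Summits.QuantumFields.BalabanUV.T4Continuum.Support.NE3SmoothLiftW
import Summits.QuantumFields.BalabanUV.T4Continuum.Support.MinimalActionLevels
import HarnessLib

/-!
# Support | NE7 (gen 97, ROAD-G97 §4 S3∕S4: THE SPIKE LETTERS OF AN EXACTLY TOP-NORMALISED REPRESENTATIVE): if the accumulated frame is trivial at the top (`log v_{j+1} ≡ 0`,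
# hdbar at the top level) then the residual top frame reading `f = framePotW L (j+1) W X` is SECOND ORDER and summable over the top corners —
# `Σ_z‖f z‖² ≤ 2B₂(X)`, `Σ_z‖f z‖ ≤ B₁(X)` with this generation's corner letters (both `≤ C·l2sq X`, N-free) — and the CORNER SPIKES `S := gaugeDir W (spikeW M f)` that carry it
# inside `X_N` obey `dirSq S ≤ 4d·2B₂`, `curlSq_W S ≤ 4x²·#Plane·2B₂`, `Σ_{perWin}‖curl_W S‖ ≤ 2x·#Plane·B₁` — the inputs of the ν- and κ-letters of ROAD-Γ′ S4

Cell `pub-balaban`, rung (B)+1 sub-cell t4, lineage `b2b-balaban-t4-ne7-p1` (CRUX PROVER NE7 #1 = OWNER of row NE7), generation 97; memo `t4/b2b-balaban-t4-ne7-p1-g97/ROAD-G97.md` §4.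
Pure composition of this generation's `NE7AccumulatedFrameDictionary` (`framePotW_eq_sum_frameLin`, `level_dictionary`), `NE7AccumulatedFrameDefectLocal` (`norm_frameLin_le_pathAvg`),
`NE7AccumulatedFrameDefectCornerSums` (`sum_corners_normSq_defect_le`, `sum_corners_norm_defect_le`), `NE7AccumulatedFrameDefectRemCornerSums` (`sum_corners_sq_pathAvg_rem_le`),
`NE7AccumulatedFrameDefectRemCornerSumsL1` (`sum_corners_sum_pathAvg_rem_le`), `NE7CornerSpikeTopDictionary` (`dirSq_gaugeDir_spikeW_le`, `curlSq_gaugeDir_spikeW_le`), row NE3's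
`NE3CornerSpikes` and `NE3CurlOfGaugeDir.norm_curlAt_gaugeDir_le`, and `NE3SmoothLiftW.framePotW_add_period`.

WHY (memo §4 S2–S4).  After the exact top frame normalisation (S2) the representative `X₂` has `log v_top[X₂] ≡ 0`, so `D X₂ = Rem₂ + gaugeDir_top(f)` with `f = framePotW X₂`; the
spikes `S` realise a preimage of `gaugeDir_top(f)` under `D` (`NE7CornerSpikeTopDictionary.dirIter_gaugeDir_spikeW`) at energy `M⁻²·dirSq S + curlSq S` and κ-cost
`(ε∕M²)Σ_{perWin}‖curl S‖`; THIS FILE bounds all three by the global `l2sq X` with constants carrying at most `M·b²` resp. `(j+1)j·b²` (ν) and no sup factor (κ) — k-free against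
`M⁻²` resp. `ε²M⁻⁴` (memo §2 (R4)).  The regauging S2 itself, the split S3 and the Ξ-part letters are NOT here.
WHAT ([folklore]; 0 def, 0 sorry).  §1 `sum_block_norm_spikeW`, `sum_norm_curl_gaugeDir_spikeW_le` (ℓ¹ curl of the spikes).  §2 under `htop : ∀ z, mlog (v_{j+1}(z)) = 0`:
`norm_framePotW_le_of_top` (pointwise: `‖f z‖ ≤ h_z + Σ_m PA_m(rem_m)(z)`), **`sum_corners_normSq_framePotW_le_of_top`**, **`sum_corners_norm_framePotW_le_of_top`**.
§3 **`dirSq_spikes_le_of_top`**, **`curlSq_spikes_le_of_top`**, **`sum_norm_curl_spikes_le_of_top`**.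
HONEST FRAMING (page 1): composition of landed kernel theorems; nothing of Bałaban's asserted; S2 (the existence of such a representative), S3, the Ξ-part letters, `hdecomp♭`, NE7 NOT
proved; spine 0∕9; finite T⁴ rung (B)+1 — NOT infinite volume, NOT mass gap, NOT `BetaPertH`, NOT Clay.  Continuum YM on T⁴ ⇐ BetaPertH ∧ nine spine estimates (0/9 proved); BetaPertH ⇐
(D1) ∧ (D4) ∧ CAP+tail; G-an2-4 gates asym, D1 and NE2/3/4.
-/

set_option autoImplicit false

open scoped BigOperators Matrix Matrix.Norms.L2Operator
open NormedSpace Finset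

namespace Summit.QuantumFields.BalabanUV.T4Continuum.NE7TopFrameReadingSpikeLetters

open Literature.MathematicalPhysics.QuantumFieldTheory.Balaban1983to89
open B7Prop1Explicit B7Prop2Explicit B7Prop3Flat MatrixLog
open B7Eq92Concrete (vcov)
open B7Prop4GeneralLevels (logCovIter)
open T4AveragingDeficitWall (Ad IsUnitaryCfg SmallField curl curlAt curlSq dirSq)
open T4AveragingDeficitWallBoundary (IsPeriodicCfg periodBox)
open AveragingDeficitPeriodicCounting (IsPeriodicDir)
open AveragingDeficitTransport (lnorm)
open AveragingDeficitNearIdentity (lnorm_nonneg)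
open AveragingDeficitMultiLevelPrep (cavgIter LevelSmall tower)
open AveragingDeficitMultiLevelBridge (cavgIter_eq_avgIter)
open ReplicationRightInverseBound (radSum)
open BlockAverageVaryHolo (nbRad)
open NE3CovariantLineSumsError (Csup)
open BlockAveragePushDirSplit (frameLin)
open BlockAveragePushDirGauge (gaugeDir)
open NE3TangentCovariantTower (QbarIter framePotW)
open NE3.QbarDictionary (adField)
open NE3.PairLandauB8Avg (relPert)
open NE3CovariantLineSumsL2 (l2sq l2sq_nonneg)
open ShellMeasureAverageProp4General (C1cov C1cov_pos)
open NE3FramePotBoundW (tower_eq_pow_mul)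
open NE3CornerSpikes (spikeW r0 spikeW_block)
open NE3BlockLineAverage (sum_periodBox_blocks)
open NE3CurlOfGaugeDir (norm_curlAt_gaugeDir_le)
open NE3SmoothLiftW (framePotW_add_period)
open MinimalActionLevels (perWin)
open NE7AccumulatedFrameDictionary (frameLin_sub framePotW_eq_sum_frameLin level_dictionary)
open NE7AccumulatedFrameDefectLocal (norm_frameLin_le_pathAvg)
open NE7AccumulatedFrameDefectCornerSums (sum_corners_normSq_defect_le sum_corners_norm_defect_le)
open NE7AccumulatedFrameDefectRemCornerSums (sum_corners_sq_pathAvg_rem_le)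
open NE7AccumulatedFrameDefectRemCornerSumsL1 (sum_corners_sum_pathAvg_rem_le)
open NE7CornerSpikeTopDictionary (dirSq_gaugeDir_spikeW_le curlSq_gaugeDir_spikeW_le)

noncomputable section

variable {d : ℕ} {n : Type*} [Fintype n] [DecidableEq n]

/-! ## §1 The ℓ¹ mass and the ℓ¹ curl of a spike gauge direction -/

/-- The spike field over one block, in ℓ¹: `Σ_{v∈[0,M)^d} ‖spikeW M h (M•z + v)‖ = ‖h z‖` (`M ≥ 1`). [folklore] -/
theorem sum_block_norm_spikeW {M : ℕ} (hM : 1 ≤ M) (h : Site d → Matrix n n ℂ) (z : Site d) :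
    ∑ v ∈ periodBox (d := d) M, ‖spikeW M h ((M : ℤ) • z + v)‖ = ‖h z‖ := by
  rw [← NE3BlockLineAverage.sum_univ_boxVec M (fun v => ‖spikeW M h ((M : ℤ) • z + v)‖), Finset.sum_eq_single (r0 hM)]
  · rw [spikeW_block hM, if_pos rfl]
  · intro r _ hr
    rw [spikeW_block hM, if_neg hr, norm_zero]
  · intro h0; exact absurd (Finset.mem_univ _) h0

/-- **THE ℓ¹ CURL OF THE CORNER SPIKES**: for `M ≥ 1`, a unitary `W` with `SmallField W a`, `Σ_{p∈perWin(M·N)} ‖curl_W (gaugeDir W (spikeW M h)) p‖ ≤ 2a·#Plane·Σ_{z∈[0,N)^d}‖h z‖`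
(the linearised curl of a gauge direction at a plaquette is the commutator with the plaquette variable: `NE3CurlOfGaugeDir.norm_curlAt_gaugeDir_le`). [folklore] -/
theorem sum_norm_curl_gaugeDir_spikeW_le [Nonempty n] {M : ℕ} (hM : 1 ≤ M) (N : ℕ) {W : Site d → Fin d → (Matrix n n ℂ)ˣ} (hW : IsUnitaryCfg W)
    {a : ℝ} (hWa : SmallField W a) (h : Site d → Matrix n n ℂ) :
    ∑ p ∈ perWin d (M * N), ‖curl W (gaugeDir W (spikeW M h)) p‖
      ≤ 2 * a * (Fintype.card (T4AveragingDeficitWall.Plane d)) * ∑ z ∈ periodBox (d := d) N, ‖h z‖ := by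
  unfold perWin
  rw [Finset.sum_product]
  have hpt : ∀ (z : Site d) (π : T4AveragingDeficitWall.Plane d), ‖curl W (gaugeDir W (spikeW M h)) (z, π)‖ ≤ 2 * a * ‖spikeW M h z‖ := by
    intro z π
    have hne : π.1.1 ≠ π.1.2 := ne_of_lt π.2
    exact norm_curlAt_gaugeDir_le hW hWa (spikeW M h) z hne
  have hS : ∑ z ∈ periodBox (d := d) (M * N), ‖spikeW M h z‖ = ∑ z ∈ periodBox (d := d) N, ‖h z‖ := by
    rw [← sum_periodBox_blocks M N hM]
    exact Finset.sum_congr rfl fun z _ => sum_block_norm_spikeW hM h z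
  calc ∑ z ∈ periodBox (d := d) (M * N), ∑ π : T4AveragingDeficitWall.Plane d, ‖curl W (gaugeDir W (spikeW M h)) (z, π)‖
      ≤ ∑ z ∈ periodBox (d := d) (M * N), ∑ _π : T4AveragingDeficitWall.Plane d, 2 * a * ‖spikeW M h z‖ :=
        Finset.sum_le_sum fun z _ => Finset.sum_le_sum fun π _ => hpt z π
    _ = 2 * a * (Fintype.card (T4AveragingDeficitWall.Plane d)) * ∑ z ∈ periodBox (d := d) (M * N), ‖spikeW M h z‖ := by
        rw [Finset.mul_sum]
        refine Finset.sum_congr rfl fun z _ => ?_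
        rw [Finset.sum_const, Finset.card_univ, nsmul_eq_mul]; ring
    _ = 2 * a * (Fintype.card (T4AveragingDeficitWall.Plane d)) * ∑ z ∈ periodBox (d := d) N, ‖h z‖ := by rw [hS]

/-! ## §2 The residual top frame reading of an exactly top-normalised representative -/

/-- **POINTWISE**: in the Prop-4 regime at level `k` (hypotheses of `NE7AccumulatedFrameDictionary.level_dictionary`), if `log v_k(z) = 0` then
`‖framePotW L k W X z‖ ≤ ‖log v_k(z) − Σ_{m<k} frameLin L W̄^m ψ_m (L^{k−m}z)‖ + Σ_{m<k} PA_m(ψ_m − QbarIter_m X)(L^{k−m}z)` (the dictionary and the frames of the Prop-4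
remainders). [folklore] -/
theorem norm_framePotW_le_of_top [Nonempty n] {L : ℕ} (hL : 2 ≤ L) (k : ℕ)
    {W : Site d → Fin d → (Matrix n n ℂ)ˣ} (hWu : IsUnitaryCfg W) {X : Site d → Fin d → Matrix n n ℂ}
    {α₀ b : ℝ} (hα : 0 < α₀) (hα3 : C0 d * α₀ ≤ 1 / 3) (hα4 : 4 * α₀ ≤ c2' d L)
    (h52 : pdev W < α₀ * (((L : ℝ) ^ k)⁻¹) ^ 2) (hb : 0 ≤ b) (hX : ∀ (y : Site d) (κ : Fin d), ‖X y κ‖ ≤ b)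
    (hsmall : Real.exp (4 * (800 * ((d : ℝ) + 1) ^ 2 * ((d : ℝ) + 4)) * α₀)
      * (1 + 8 * (131072 * ((d : ℝ) + 1) ^ 2) * ((L : ℝ) ^ k * b)) ≤ 2)
    (hc₃ : 2 * ((L : ℝ) ^ k * b) ≤ c3 d L) {z : Site d}
    (htop : mlog ((vcov L W (relPert W X) k z : (Matrix n n ℂ)ˣ) : Matrix n n ℂ) = 0) :
    ‖framePotW L k W X z‖
      ≤ ‖mlog ((vcov L W (relPert W X) k z : (Matrix n n ℂ)ˣ) : Matrix n n ℂ)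
          - ∑ m ∈ range k, frameLin L (avgIter L W m)
              (fun x μ => Ad (avgIter L W m x μ)⁻¹ (logCovIter L W (adField W X) m x μ)) (((L : ℤ) ^ (k - m)) • z)‖
        + ∑ m ∈ range k, ((L : ℝ) ^ d)⁻¹ * ∑ r : Fin d → Fin L,
              lnorm (fun x μ => Ad (avgIter L W m x μ)⁻¹ (logCovIter L W (adField W X) m x μ) - QbarIter L m W X x μ)
                (((L : ℤ) ^ (k - m)) • z) (treeWord (boxVec L r)) := by
  letI : CStarAlgebra (Matrix n n ℂ) := {}
  have hdict := level_dictionary hL k hWu (X := X) hα hα3 hα4 h52 hb hX hsmall hc₃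
  set ψ : ℕ → Site d → Fin d → Matrix n n ℂ := fun m x μ => Ad (avgIter L W m x μ)⁻¹ (logCovIter L W (adField W X) m x μ) with hψ
  set y : ℕ → Site d := fun m => ((L : ℤ) ^ (k - m)) • z with hy
  have hrem : ‖∑ m ∈ range k, frameLin L (avgIter L W m) (ψ m) (y m) - framePotW L k W X z‖
      ≤ ∑ m ∈ range k, ((L : ℝ) ^ d)⁻¹ * ∑ r : Fin d → Fin L, lnorm (fun x μ => ψ m x μ - QbarIter L m W X x μ) (y m) (treeWord (boxVec L r)) := by
    rw [framePotW_eq_sum_frameLin L W X k z]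
    have e : ∑ m ∈ range k, frameLin L (cavgIter L m W) (QbarIter L m W X) (((L : ℤ) ^ (k - m)) • z)
        = ∑ m ∈ range k, frameLin L (avgIter L W m) (QbarIter L m W X) (y m) :=
      Finset.sum_congr rfl fun m _ => by rw [cavgIter_eq_avgIter]
    rw [e, ← Finset.sum_sub_distrib]
    refine (norm_sum_le _ _).trans (Finset.sum_le_sum fun m hm => ?_)
    obtain ⟨hUm, -, -, -, -⟩ := hdict m (Finset.mem_range.mp hm).le
    rw [frameLin_sub]
    exact norm_frameLin_le_pathAvg L hUm _ (y m)
  set M₀ : Matrix n n ℂ := mlog ((vcov L W (relPert W X) k z : (Matrix n n ℂ)ˣ) : Matrix n n ℂ) with hM₀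
  set S : Matrix n n ℂ := ∑ m ∈ range k, frameLin L (avgIter L W m) (ψ m) (y m) with hS
  have hM0 : M₀ = 0 := htop
  have e1 : (S - framePotW L k W X z) - (S - M₀) = -framePotW L k W X z := by rw [hM0, sub_zero, sub_sub_cancel_left]
  calc ‖framePotW L k W X z‖ = ‖(S - framePotW L k W X z) - (S - M₀)‖ := by rw [e1, norm_neg]
    _ ≤ ‖S - framePotW L k W X z‖ + ‖S - M₀‖ := norm_sub_le _ _
    _ = ‖M₀ - S‖ + ‖S - framePotW L k W X z‖ := by rw [norm_sub_rev S M₀, add_comm]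
    _ ≤ _ := add_le_add le_rfl hrem

/-- **THE ℓ²-OVER-CORNERS LETTER OF THE RESIDUAL TOP FRAME READING** (tower class at `W`, Prop-4 regime at the top level `j+1`, `44dL·L^{j+1}b ≤ 1`, and `log v_{j+1} ≡ 0` on the top
corners): `Σ_{z∈[0,N)^d}‖framePotW L (j+1) W X z‖² ≤ 2·(4096d³L⁵b²L^{j+1}(Σ_m L^mρ₂^m)·l2sq X) + 2·((j+1)·dL·1024K²b²(Σ_{i<j}(L²ρ₂)^i)·l2sq X)`. [folklore] -/
theorem sum_corners_normSq_framePotW_le_of_top [Nonempty n] {L N : ℕ} (hL : 2 ≤ L) (hN : 1 ≤ N) (j : ℕ)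
    {W : Site d → Fin d → (Matrix n n ℂ)ˣ} {x : ℝ} (hWu : IsUnitaryCfg W) (hWP : IsPeriodicCfg W ((N * L ^ (j + 1) : ℕ) : ℤ))
    (hx : 0 ≤ x) (hsm : LevelSmall d L j x) (hWx : SmallField W x)
    {α₀ b : ℝ} (hα : 0 < α₀) (hα3 : C0 d * (2 * α₀) ≤ 1 / 3) (hα4 : 4 * (2 * α₀) ≤ c2' d L)
    (h52 : pdev W < α₀ * (((L : ℝ) ^ (j + 1))⁻¹) ^ 2) (hb : 0 ≤ b)
    {X : Site d → Fin d → Matrix n n ℂ} (hX : ∀ (y : Site d) (κ : Fin d), ‖X y κ‖ ≤ b) (hXP : IsPeriodicDir X ((N * L ^ (j + 1) : ℕ) : ℤ))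
    (hsmall : Real.exp (4 * (800 * ((d : ℝ) + 1) ^ 2 * ((d : ℝ) + 4)) * α₀)
      * (1 + 8 * (131072 * ((d : ℝ) + 1) ^ 2) * ((L : ℝ) ^ (j + 1) * b)) ≤ 2)
    (hc₃ : 4 * ((L : ℝ) ^ (j + 1) * b) ≤ c3 d L)
    (hK : 16 * (C1cov d * (L : ℝ) ^ 2 * Real.sqrt (d * (2 * (2 * L) + 1) ^ d)) * (L : ℝ) ^ (j + 1) * b ≤ Real.sqrt ((L : ℝ) ^ 2 / (L : ℝ) ^ d))
    (h44 : 44 * ((d : ℝ) * L * ((L : ℝ) ^ (j + 1) * b)) ≤ 1)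
    (htop : ∀ z : Site d, mlog ((vcov L W (relPert W X) (j + 1) z : (Matrix n n ℂ)ˣ) : Matrix n n ℂ) = 0) :
    ∑ z ∈ periodBox (d := d) N, ‖framePotW L (j + 1) W X z‖ ^ 2
      ≤ 2 * (4096 * ((d : ℝ) ^ 3 * (L : ℝ) ^ 5) * b ^ 2 * (L : ℝ) ^ (j + 1)
            * (∑ m ∈ range (j + 1), (L : ℝ) ^ m * ((L : ℝ) ^ 2 / (L : ℝ) ^ d) ^ m) * l2sq (periodBox (d := d) (N * L ^ (j + 1))) X)
        + 2 * (((j : ℝ) + 1) * (((d : ℝ) * L) * (1024 * (C1cov d * (L : ℝ) ^ 2 * Real.sqrt (d * (2 * (2 * L) + 1) ^ d)) ^ 2 * b ^ 2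
            * (∑ i ∈ range j, ((L : ℝ) ^ 2 * ((L : ℝ) ^ 2 / (L : ℝ) ^ d)) ^ i) * l2sq (periodBox (d := d) (N * L ^ (j + 1))) X))) := by
  letI : CStarAlgebra (Matrix n n ℂ) := {}
  have hL0 : (0 : ℝ) < L := by exact_mod_cast (show 0 < L by omega)
  have hα3' : C0 d * α₀ ≤ 1 / 3 := by nlinarith [show (0 : ℝ) ≤ C0 d by unfold C0; positivity]
  have hα4' : 4 * α₀ ≤ c2' d L := by linarith
  have hc₃' : 2 * ((L : ℝ) ^ (j + 1) * b) ≤ c3 d L := by nlinarith [pow_pos hL0 (j + 1)]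
  have hA := sum_corners_normSq_defect_le hL hN j hWu hWP hx hsm hWx hα hα3 hα4 h52 hb hX hXP hsmall hc₃ hK h44
  have hB := sum_corners_sq_pathAvg_rem_le hL hN j hWu hWP hx hsm hWx hα hα3 hα4 h52 hb hX hXP hsmall hc₃ hK
  -- pointwise: `‖f z‖ ≤ a_z + b_z`, hence `‖f z‖² ≤ 2a_z² + 2b_z²`
  have hpt : ∀ z : Site d, ‖framePotW L (j + 1) W X z‖ ^ 2
      ≤ 2 * ‖mlog ((vcov L W (relPert W X) (j + 1) z : (Matrix n n ℂ)ˣ) : Matrix n n ℂ)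
            - ∑ m ∈ range (j + 1), frameLin L (avgIter L W m)
                (fun x' μ => Ad (avgIter L W m x' μ)⁻¹ (logCovIter L W (adField W X) m x' μ)) (((L : ℤ) ^ (j + 1 - m)) • z)‖ ^ 2
        + 2 * (∑ m ∈ range (j + 1), ((L : ℝ) ^ d)⁻¹ * ∑ r : Fin d → Fin L,
              lnorm (fun x' μ => Ad (avgIter L W m x' μ)⁻¹ (logCovIter L W (adField W X) m x' μ) - QbarIter L m W X x' μ)
                (((L : ℤ) ^ (j + 1 - m)) • z) (treeWord (boxVec L r))) ^ 2 := by
    intro z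
    have h := norm_framePotW_le_of_top hL (j + 1) hWu hα hα3' hα4' h52 hb hX hsmall hc₃' (htop z)
    have h0 : 0 ≤ ‖framePotW L (j + 1) W X z‖ := norm_nonneg _
    nlinarith [h, h0, sq_nonneg (‖mlog ((vcov L W (relPert W X) (j + 1) z : (Matrix n n ℂ)ˣ) : Matrix n n ℂ)
            - ∑ m ∈ range (j + 1), frameLin L (avgIter L W m)
                (fun x' μ => Ad (avgIter L W m x' μ)⁻¹ (logCovIter L W (adField W X) m x' μ)) (((L : ℤ) ^ (j + 1 - m)) • z)‖
        - ∑ m ∈ range (j + 1), ((L : ℝ) ^ d)⁻¹ * ∑ r : Fin d → Fin L,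
              lnorm (fun x' μ => Ad (avgIter L W m x' μ)⁻¹ (logCovIter L W (adField W X) m x' μ) - QbarIter L m W X x' μ)
                (((L : ℤ) ^ (j + 1 - m)) • z) (treeWord (boxVec L r)))]
  refine (Finset.sum_le_sum fun z _ => hpt z).trans ?_
  rw [Finset.sum_add_distrib, ← Finset.mul_sum, ← Finset.mul_sum]
  exact add_le_add (mul_le_mul_of_nonneg_left hA (by norm_num)) (mul_le_mul_of_nonneg_left hB (by norm_num))

/-- **THE ℓ¹-OVER-CORNERS LETTER OF THE RESIDUAL TOP FRAME READING** (same regime plus the ℓ¹ tower line `hS1`, and `log v_{j+1} ≡ 0`):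
`Σ_{z∈[0,N)^d}‖framePotW L (j+1) W X z‖ ≤ 16dL(6Σ_mL^mρ₂^m + 2Σ_mρ₂^m)·l2sq X + 64C₁L²d(4L+1)^d(Σ_{i<j}((L∕L^d)L)^i)·l2sq X` — no sup factor, N-free. [folklore] -/
theorem sum_corners_norm_framePotW_le_of_top [Nonempty n] {L N : ℕ} (hL : 2 ≤ L) (hN : 1 ≤ N) (j : ℕ)
    {W : Site d → Fin d → (Matrix n n ℂ)ˣ} {x : ℝ} (hWu : IsUnitaryCfg W) (hWP : IsPeriodicCfg W ((N * L ^ (j + 1) : ℕ) : ℤ))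
    (hx : 0 ≤ x) (hsm : LevelSmall d L j x) (hWx : SmallField W x)
    {α₀ b : ℝ} (hα : 0 < α₀) (hα3 : C0 d * (2 * α₀) ≤ 1 / 3) (hα4 : 4 * (2 * α₀) ≤ c2' d L)
    (h52 : pdev W < α₀ * (((L : ℝ) ^ (j + 1))⁻¹) ^ 2) (hb : 0 ≤ b)
    {X : Site d → Fin d → Matrix n n ℂ} (hX : ∀ (y : Site d) (κ : Fin d), ‖X y κ‖ ≤ b) (hXP : IsPeriodicDir X ((N * L ^ (j + 1) : ℕ) : ℤ))
    (hsmall : Real.exp (4 * (800 * ((d : ℝ) + 1) ^ 2 * ((d : ℝ) + 4)) * α₀)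
      * (1 + 8 * (131072 * ((d : ℝ) + 1) ^ 2) * ((L : ℝ) ^ (j + 1) * b)) ≤ 2)
    (hc₃ : 4 * ((L : ℝ) ^ (j + 1) * b) ≤ c3 d L)
    (hK : 16 * (C1cov d * (L : ℝ) ^ 2 * Real.sqrt (d * (2 * (2 * L) + 1) ^ d)) * (L : ℝ) ^ (j + 1) * b ≤ Real.sqrt ((L : ℝ) ^ 2 / (L : ℝ) ^ d))
    (hS1 : (16 * (d + 1) * (d + 4) * (L : ℝ) ^ 2 * Csup d L * (d * (2 * nbRad d L + 1) ^ d)) * radSum d L j x ≤ ((L : ℝ) / (L : ℝ) ^ d) / 2)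
    (h44 : 44 * ((d : ℝ) * L * ((L : ℝ) ^ (j + 1) * b)) ≤ 1)
    (htop : ∀ z : Site d, mlog ((vcov L W (relPert W X) (j + 1) z : (Matrix n n ℂ)ˣ) : Matrix n n ℂ) = 0) :
    ∑ z ∈ periodBox (d := d) N, ‖framePotW L (j + 1) W X z‖
      ≤ 16 * ((d : ℝ) * L) * (6 * (∑ m ∈ range (j + 1), (L : ℝ) ^ m * ((L : ℝ) ^ 2 / (L : ℝ) ^ d) ^ m)
            + 2 * ∑ m ∈ range (j + 1), ((L : ℝ) ^ 2 / (L : ℝ) ^ d) ^ m) * l2sq (periodBox (d := d) (N * L ^ (j + 1))) X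
        + 64 * (C1cov d * (L : ℝ) ^ 2 * (d * (2 * (2 * (L : ℝ)) + 1) ^ d)) * (∑ i ∈ range j, (((L : ℝ) / (L : ℝ) ^ d) * L) ^ i)
            * l2sq (periodBox (d := d) (N * L ^ (j + 1))) X := by
  letI : CStarAlgebra (Matrix n n ℂ) := {}
  have hL0 : (0 : ℝ) < L := by exact_mod_cast (show 0 < L by omega)
  have hα3' : C0 d * α₀ ≤ 1 / 3 := by nlinarith [show (0 : ℝ) ≤ C0 d by unfold C0; positivity]
  have hα4' : 4 * α₀ ≤ c2' d L := by linarith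
  have hc₃' : 2 * ((L : ℝ) ^ (j + 1) * b) ≤ c3 d L := by nlinarith [pow_pos hL0 (j + 1)]
  have hA := sum_corners_norm_defect_le hL hN j hWu hWP hx hsm hWx hα hα3 hα4 h52 hb hX hXP hsmall hc₃ hK h44
  have hB := sum_corners_sum_pathAvg_rem_le hL hN j hWu hWP hx hsm hWx hα hα3 hα4 h52 hb hX hXP hsmall hc₃ hK hS1
  have hpt : ∀ z : Site d, ‖framePotW L (j + 1) W X z‖
      ≤ ‖mlog ((vcov L W (relPert W X) (j + 1) z : (Matrix n n ℂ)ˣ) : Matrix n n ℂ)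
            - ∑ m ∈ range (j + 1), frameLin L (avgIter L W m)
                (fun x' μ => Ad (avgIter L W m x' μ)⁻¹ (logCovIter L W (adField W X) m x' μ)) (((L : ℤ) ^ (j + 1 - m)) • z)‖
        + ∑ m ∈ range (j + 1), ((L : ℝ) ^ d)⁻¹ * ∑ r : Fin d → Fin L,
              lnorm (fun x' μ => Ad (avgIter L W m x' μ)⁻¹ (logCovIter L W (adField W X) m x' μ) - QbarIter L m W X x' μ)
                (((L : ℤ) ^ (j + 1 - m)) • z) (treeWord (boxVec L r)) :=
    fun z => norm_framePotW_le_of_top hL (j + 1) hWu hα hα3' hα4' h52 hb hX hsmall hc₃' (htop z)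
  refine (Finset.sum_le_sum fun z _ => hpt z).trans ?_
  rw [Finset.sum_add_distrib]
  exact add_le_add hA hB

/-! ## §3 The letters of the corner spikes carrying the residual top frame reading -/

/-- **THE ℓ² LETTERS OF THE SPIKES** (same regime as `sum_corners_normSq_framePotW_le_of_top`): with `M = L^{j+1}` and `S := gaugeDir W (spikeW M (framePotW L (j+1) W X))`,
`dirSq S [0,M·N)^d ≤ 4d·(Σ_z‖f z‖²-bound)` and `curlSq_W S [0,M·N)^d ≤ 4x²·#Plane·(Σ_z‖f z‖²-bound)` — against the weight `M⁻²` of `energyNormW` the first is the k-free ν-cost of the spikes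
(memo §2 (R4)). [folklore] -/
theorem dirSq_curlSq_spikes_le_of_top [Nonempty n] {L N : ℕ} [NeZero N] (hL : 2 ≤ L) (hN : 1 ≤ N) (j : ℕ)
    {W : Site d → Fin d → (Matrix n n ℂ)ˣ} {x : ℝ} (hWu : IsUnitaryCfg W) (hWP : IsPeriodicCfg W ((N * L ^ (j + 1) : ℕ) : ℤ))
    (hx : 0 ≤ x) (hsm : LevelSmall d L j x) (hWx : SmallField W x)
    {α₀ b : ℝ} (hα : 0 < α₀) (hα3 : C0 d * (2 * α₀) ≤ 1 / 3) (hα4 : 4 * (2 * α₀) ≤ c2' d L)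
    (h52 : pdev W < α₀ * (((L : ℝ) ^ (j + 1))⁻¹) ^ 2) (hb : 0 ≤ b)
    {X : Site d → Fin d → Matrix n n ℂ} (hX : ∀ (y : Site d) (κ : Fin d), ‖X y κ‖ ≤ b) (hXP : IsPeriodicDir X ((N * L ^ (j + 1) : ℕ) : ℤ))
    (hsmall : Real.exp (4 * (800 * ((d : ℝ) + 1) ^ 2 * ((d : ℝ) + 4)) * α₀)
      * (1 + 8 * (131072 * ((d : ℝ) + 1) ^ 2) * ((L : ℝ) ^ (j + 1) * b)) ≤ 2)
    (hc₃ : 4 * ((L : ℝ) ^ (j + 1) * b) ≤ c3 d L)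
    (hK : 16 * (C1cov d * (L : ℝ) ^ 2 * Real.sqrt (d * (2 * (2 * L) + 1) ^ d)) * (L : ℝ) ^ (j + 1) * b ≤ Real.sqrt ((L : ℝ) ^ 2 / (L : ℝ) ^ d))
    (h44 : 44 * ((d : ℝ) * L * ((L : ℝ) ^ (j + 1) * b)) ≤ 1)
    (htop : ∀ z : Site d, mlog ((vcov L W (relPert W X) (j + 1) z : (Matrix n n ℂ)ˣ) : Matrix n n ℂ) = 0) :
    dirSq (gaugeDir W (spikeW (L ^ (j + 1)) (framePotW L (j + 1) W X))) (periodBox (d := d) (L ^ (j + 1) * N))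
        ≤ 4 * (d : ℝ) * (2 * (4096 * ((d : ℝ) ^ 3 * (L : ℝ) ^ 5) * b ^ 2 * (L : ℝ) ^ (j + 1)
            * (∑ m ∈ range (j + 1), (L : ℝ) ^ m * ((L : ℝ) ^ 2 / (L : ℝ) ^ d) ^ m) * l2sq (periodBox (d := d) (N * L ^ (j + 1))) X)
          + 2 * (((j : ℝ) + 1) * (((d : ℝ) * L) * (1024 * (C1cov d * (L : ℝ) ^ 2 * Real.sqrt (d * (2 * (2 * L) + 1) ^ d)) ^ 2 * b ^ 2
            * (∑ i ∈ range j, ((L : ℝ) ^ 2 * ((L : ℝ) ^ 2 / (L : ℝ) ^ d)) ^ i) * l2sq (periodBox (d := d) (N * L ^ (j + 1))) X))))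
      ∧ curlSq W (gaugeDir W (spikeW (L ^ (j + 1)) (framePotW L (j + 1) W X))) (periodBox (d := d) (L ^ (j + 1) * N))
        ≤ 4 * x ^ 2 * (Fintype.card (T4AveragingDeficitWall.Plane d)) * (2 * (4096 * ((d : ℝ) ^ 3 * (L : ℝ) ^ 5) * b ^ 2 * (L : ℝ) ^ (j + 1)
            * (∑ m ∈ range (j + 1), (L : ℝ) ^ m * ((L : ℝ) ^ 2 / (L : ℝ) ^ d) ^ m) * l2sq (periodBox (d := d) (N * L ^ (j + 1))) X)
          + 2 * (((j : ℝ) + 1) * (((d : ℝ) * L) * (1024 * (C1cov d * (L : ℝ) ^ 2 * Real.sqrt (d * (2 * (2 * L) + 1) ^ d)) ^ 2 * b ^ 2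
            * (∑ i ∈ range j, ((L : ℝ) ^ 2 * ((L : ℝ) ^ 2 / (L : ℝ) ^ d)) ^ i) * l2sq (periodBox (d := d) (N * L ^ (j + 1))) X)))) := by
  have hM : 1 ≤ L ^ (j + 1) := Nat.one_le_pow _ L (by omega)
  have hT : ((tower L N (j + 1) : ℕ) : ℤ) = ((N * L ^ (j + 1) : ℕ) : ℤ) := by rw [tower_eq_pow_mul, Nat.mul_comm]
  have hWPt : IsPeriodicCfg W ((tower L N (j + 1) : ℕ) : ℤ) := by rw [hT]; exact hWP
  have hXPt : IsPeriodicDir X ((tower L N (j + 1) : ℕ) : ℤ) := by rw [hT]; exact hXP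
  have hfP : ∀ (z : Site d) (τ : Fin d), framePotW L (j + 1) W X (z + (N : ℤ) • e τ) = framePotW L (j + 1) W X z :=
    framePotW_add_period L j hWPt hXPt
  have h2 := sum_corners_normSq_framePotW_le_of_top hL hN j hWu hWP hx hsm hWx hα hα3 hα4 h52 hb hX hXP hsmall hc₃ hK h44 htop
  refine ⟨?_, ?_⟩
  · exact (dirSq_gaugeDir_spikeW_le hM hN hWu hfP).trans (mul_le_mul_of_nonneg_left h2 (by positivity))
  · exact (curlSq_gaugeDir_spikeW_le hM N hWu hWx (framePotW L (j + 1) W X)).trans (mul_le_mul_of_nonneg_left h2 (by positivity))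

/-- **THE ℓ¹ CURL LETTER OF THE SPIKES** (same regime as `sum_corners_norm_framePotW_le_of_top`): `Σ_{p∈perWin(M·N)}‖curl_W S p‖ ≤ 2x·#Plane·(Σ_z‖f z‖-bound)` — no sup factor, N-free;
with the prefactor `ε∕M²` of the κ-letter and `x = ε∕M²`-type smallness this is the `ε²M⁻⁴`-room of memo §2 (R4). [folklore] -/
theorem sum_norm_curl_spikes_le_of_top [Nonempty n] {L N : ℕ} (hL : 2 ≤ L) (hN : 1 ≤ N) (j : ℕ)
    {W : Site d → Fin d → (Matrix n n ℂ)ˣ} {x : ℝ} (hWu : IsUnitaryCfg W) (hWP : IsPeriodicCfg W ((N * L ^ (j + 1) : ℕ) : ℤ))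
    (hx : 0 ≤ x) (hsm : LevelSmall d L j x) (hWx : SmallField W x)
    {α₀ b : ℝ} (hα : 0 < α₀) (hα3 : C0 d * (2 * α₀) ≤ 1 / 3) (hα4 : 4 * (2 * α₀) ≤ c2' d L)
    (h52 : pdev W < α₀ * (((L : ℝ) ^ (j + 1))⁻¹) ^ 2) (hb : 0 ≤ b)
    {X : Site d → Fin d → Matrix n n ℂ} (hX : ∀ (y : Site d) (κ : Fin d), ‖X y κ‖ ≤ b) (hXP : IsPeriodicDir X ((N * L ^ (j + 1) : ℕ) : ℤ))
    (hsmall : Real.exp (4 * (800 * ((d : ℝ) + 1) ^ 2 * ((d : ℝ) + 4)) * α₀)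
      * (1 + 8 * (131072 * ((d : ℝ) + 1) ^ 2) * ((L : ℝ) ^ (j + 1) * b)) ≤ 2)
    (hc₃ : 4 * ((L : ℝ) ^ (j + 1) * b) ≤ c3 d L)
    (hK : 16 * (C1cov d * (L : ℝ) ^ 2 * Real.sqrt (d * (2 * (2 * L) + 1) ^ d)) * (L : ℝ) ^ (j + 1) * b ≤ Real.sqrt ((L : ℝ) ^ 2 / (L : ℝ) ^ d))
    (hS1 : (16 * (d + 1) * (d + 4) * (L : ℝ) ^ 2 * Csup d L * (d * (2 * nbRad d L + 1) ^ d)) * radSum d L j x ≤ ((L : ℝ) / (L : ℝ) ^ d) / 2)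
    (h44 : 44 * ((d : ℝ) * L * ((L : ℝ) ^ (j + 1) * b)) ≤ 1)
    (htop : ∀ z : Site d, mlog ((vcov L W (relPert W X) (j + 1) z : (Matrix n n ℂ)ˣ) : Matrix n n ℂ) = 0) :
    ∑ p ∈ perWin d (L ^ (j + 1) * N), ‖curl W (gaugeDir W (spikeW (L ^ (j + 1)) (framePotW L (j + 1) W X))) p‖
      ≤ 2 * x * (Fintype.card (T4AveragingDeficitWall.Plane d))
          * (16 * ((d : ℝ) * L) * (6 * (∑ m ∈ range (j + 1), (L : ℝ) ^ m * ((L : ℝ) ^ 2 / (L : ℝ) ^ d) ^ m)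
                + 2 * ∑ m ∈ range (j + 1), ((L : ℝ) ^ 2 / (L : ℝ) ^ d) ^ m) * l2sq (periodBox (d := d) (N * L ^ (j + 1))) X
            + 64 * (C1cov d * (L : ℝ) ^ 2 * (d * (2 * (2 * (L : ℝ)) + 1) ^ d)) * (∑ i ∈ range j, (((L : ℝ) / (L : ℝ) ^ d) * L) ^ i)
                * l2sq (periodBox (d := d) (N * L ^ (j + 1))) X) := by
  have hM : 1 ≤ L ^ (j + 1) := Nat.one_le_pow _ L (by omega)
  have h1 := sum_corners_norm_framePotW_le_of_top hL hN j hWu hWP hx hsm hWx hα hα3 hα4 h52 hb hX hXP hsmall hc₃ hK hS1 h44 htop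
  exact (sum_norm_curl_gaugeDir_spikeW_le hM N hWu hWx (framePotW L (j + 1) W X)).trans (mul_le_mul_of_nonneg_left h1 (by positivity))

end

end Summit.QuantumFields.BalabanUV.T4Continuum.NE7TopFrameReadingSpikeLetters
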